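import Literature.MathematicalPhysics.QuantumFieldTheory.Balaban1983to89.T3UnitScaleTilt
import Literature.MathematicalPhysics.QuantumFieldTheory.Balaban1983to89.T3ContinuumUnitLaw
import HarnessLib

/-!
# Route `SmallFieldWidening` — THE WIDENING IN TOTAL VARIATION (support of item `WideningOfTiltAndMass`,
# stmt-QuantumFields-22885; helper — the item itself is closed by `smallFieldWidening_wideningOfTiltAndMass_proof`)

WHAT THIS IS NOT: not a proof of the route's cruxes r2 (`AllHeightsSmallTilt`, stmt-QuantumFields-22883) or r3
(`LargeFieldMassRefinementTail`, stmt-QuantumFields-22884) — the d = 3 expectations step E3 stays open —, not d = 4, not a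
mass gap, not Clay; rung R3 is a RECORD-label rung and no summit is proved here.  The file is ROUTE-INDEPENDENT (Literature
imports only): its hypotheses are the item's, spelled over the tree's `UnitTiltAt`, `histGood`, `gibbsK`, `unitLaw`.

WHAT IT IS.  The item concludes `HasContinuumLimit (F.scheme ℰp γ)`: convergence of the joint unit-loop expectations, ONE
observable string at a time.  Every estimate in the widening ([King1986] (3.9)–(3.13) with the summable bad masses replaced by a
`K`-uniform one) is UNIFORM over measurable unit-field observables `|W| ≤ 1`, so the same hypotheses give the STRONGER,
law-level statement, typed here — and by a shorter road than the landed proof (no normalised good parts):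

* §1 (pure measure theory, any measurable space).  TILTS CHAIN (`isTilt_chain`: `μ_{K+1}` a tilt of `μ_K` of radius `r_K` for
  every `K` ⇒ `μ_{K'}` a tilt of `μ_K` of radius `Σ_{K ≤ i < K'} r_i`, by `IsTilt.trans`), so the tree's four-measure lemma
  `IsTilt.abs_integral_sub_le` applied ONCE to the pair of runs `K ≤ K'` gives, for probability laws `P_K = μ_K + μ'_K` with bad
  masses `μ'_K(univ) ≤ δ` (NO smallness of `δ` needed): `|∫ W dP_{K'} − ∫ W dP_K| ≤ 8·Σ_{K ≤ i < K'} r_i + 6δ` for ALL measurable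
  `|W| ≤ 1` (`abs_integral_sub_le_of_tilt_chain_uniformMass`); with `Σ r_K < ∞`, for every `ε > 0` ONE index `K₁` serves all
  `K, K' ≥ K₁` and all `W` at once: `≤ 6δ + ε` (`uniform_abs_integral_sub_le_of_tilt_uniformMass`).
* §2 (the unit laws; `SU(2)`, printed smearing `ℰp`).  Under the item's hypotheses — all-heights unit tilt `UnitTiltAt … 0` of
  the refined family `F.refine n` at `γL^{-n}` for every `n ≥ n₀` and ONE `K`-uniform large-field mass `δ n → 0` — the unit
  laws `unitLaw F ℰp γ J` of the ORIGINAL family are UNIFORMLY CAUCHY over measurable `|g| ≤ 1` (`unitLaw_uniformCauchy`), i.e.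
  Cauchy in total variation: §1 for the refined family at a depth `n` with `6δ n < ε/2`, carried to `F` by the law-level
  refinement identity `unitLaw^{F}_{K+n} = (Π_n)_* unitLaw^{F.refine n}_K` (tree `T3ContinuumUnitLaw.unitLaw_add_eq_map_coarsen`;
  `g ∘ Π_n` is again measurable and bounded by `1`).  Corollary: the masses of all measurable events converge uniformly in the
  event (`unitLaw_real_uniformCauchy`).
* §3 (every `G`, every measurable `ℰ`).  Cauchy unit-law integrals of bounded measurable observables ⇒ `HasContinuumLimit`
  (`hasContinuumLimit_of_unitLaw_cauchySeq`, via `expectAt_eq_integral_unitLaw`): §2 SUBSUMES the item (its conclusion is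
  re-derived as `hasContinuumLimit_of_unitLaw_uniformCauchy`, stated on the item's hypotheses).
The limit LAW (an `L¹(product Haar)` density on the unit torus) is constructed in the sibling file `…TVLaw.lean`.
-/

noncomputable section

open MeasureTheory Filter Topology
open scoped ENNReal
open Literature.MathematicalPhysics.QuantumFieldTheory.Balaban1983to89
open Literature.MathematicalPhysics.QuantumFieldTheory.Balaban1983to89.Missing
open Literature.MathematicalPhysics.QuantumFieldTheory.Balaban1983to89.T3ContinuumYM3Torus
open Literature.MathematicalPhysics.QuantumFieldTheory.Balaban1983to89.T3ThresholdRemoval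
open Literature.MathematicalPhysics.QuantumFieldTheory.Balaban1983to89.T3UnitLawDensityEML (ℰp measurableE_ℰp)
open Literature.MathematicalPhysics.QuantumFieldTheory.Balaban1983to89.T3UnitScaleTilt
open Literature.MathematicalPhysics.QuantumFieldTheory.Balaban1983to89.T3ContinuumUnitLaw
open Literature.MathematicalPhysics.QuantumFieldTheory.Balaban1983to89.T4Continuum

namespace Summit.QuantumFields.YangMills.Theorems.WideningTV

/-! ## §1 Pure measure theory: tilts chain, ONE Cauchy modulus for all bounded measurable observables -/

section Abstract

variable {X : Type*} [MeasurableSpace X]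

/-- **TILTS CHAIN, RADII ADD UP**: if `μ_{K+1}` is a tilt (modulo a constant) of `μ_K` of radius `r_K` for every `K`, then for
`K ≤ K'` the law `μ_{K'}` is a tilt of `μ_K` of radius `Σ_{K ≤ i < K'} r_i` (`IsTilt.refl`, `IsTilt.trans` along the chain). -/
theorem isTilt_chain (μ : ℕ → Measure X) {r : ℕ → ℝ} (ht : ∀ K, IsTilt (μ K) (μ (K + 1)) (r K)) {K K' : ℕ}
    (hKK' : K ≤ K') : IsTilt (μ K) (μ K') (∑ i ∈ Finset.Ico K K', r i) := by
  induction K', hKK' using Nat.le_induction with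
  | base => simpa using IsTilt.refl (μ K)
  | succ K' hKK' ih =>
    rw [Finset.sum_Ico_succ_top hKK']
    exact ih.trans (ht K')

/-- **TWO RUNS FAR APART, ONE FOUR-MEASURE STEP**: probability laws `P_K = μ_K + μ'_K` with bad masses `μ'_K(univ) ≤ δ` for all
`K` and consecutive good parts tilt-related with radii `r_K`.  Then for `K ≤ K'` and EVERY measurable `|W| ≤ 1`,
`|∫ W dP_{K'} − ∫ W dP_K| ≤ 8·Σ_{K ≤ i < K'} r_i + 6δ` (the tree's `IsTilt.abs_integral_sub_le` for the chained tilt; no smallness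
of `δ`, no normalisation). -/
theorem abs_integral_sub_le_of_tilt_chain_uniformMass (P μ μ' : ℕ → Measure X)
    (hPp : ∀ K, IsProbabilityMeasure (P K)) (hP : ∀ K, P K = μ K + μ' K) {δ : ℝ}
    (hδ : ∀ K, (μ' K).real Set.univ ≤ δ) {r : ℕ → ℝ} (ht : ∀ K, IsTilt (μ K) (μ (K + 1)) (r K))
    {W : X → ℝ} (hWm : Measurable W) (hW : ∀ x, |W x| ≤ 1) {K K' : ℕ} (hKK' : K ≤ K') :
    |(∫ x, W x ∂P K') - ∫ x, W x ∂P K| ≤ 8 * ∑ i ∈ Finset.Ico K K', r i + 6 * δ := by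
  haveI : IsProbabilityMeasure (μ K + μ' K) := hP K ▸ hPp K
  haveI : IsProbabilityMeasure (μ K' + μ' K') := hP K' ▸ hPp K'
  have h := (isTilt_chain μ ht hKK').abs_integral_sub_le (μb := μ' K) (νb := μ' K') (hδ K) (hδ K') hWm hW
  rw [← hP K, ← hP K'] at h
  linarith

/-- **UNIFORMLY APPROXIMATELY CAUCHY LAWS** ([King1986] (3.9)–(3.13) with ONE `K`-uniform bad mass, read at the level of LAWS):
under the hypotheses of `abs_integral_sub_le_of_tilt_chain_uniformMass` with `Σ r_K < ∞`, for every `ε > 0` there is ONE `K₁`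
such that `|∫ W dP_K − ∫ W dP_{K'}| ≤ 6δ + ε` for all `K, K' ≥ K₁` and ALL measurable `|W| ≤ 1` — the laws are `(6δ + ε)`-close in
total variation from `K₁` on. -/
theorem uniform_abs_integral_sub_le_of_tilt_uniformMass (P μ μ' : ℕ → Measure X)
    (hPp : ∀ K, IsProbabilityMeasure (P K)) (hP : ∀ K, P K = μ K + μ' K) {δ : ℝ}
    (hδ : ∀ K, (μ' K).real Set.univ ≤ δ) {r : ℕ → ℝ} (hr : Summable r)
    (ht : ∀ K, IsTilt (μ K) (μ (K + 1)) (r K)) {ε : ℝ} (hε : 0 < ε) :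
    ∃ K₁ : ℕ, ∀ K K' : ℕ, K₁ ≤ K → K₁ ≤ K' → ∀ W : X → ℝ, Measurable W → (∀ x, |W x| ≤ 1) →
      |(∫ x, W x ∂P K) - ∫ x, W x ∂P K'| ≤ 6 * δ + ε := by
  -- the `W`-free modulus: partial sums of `8 r`
  have hS : CauchySeq fun N => ∑ i ∈ Finset.range N, 8 * r i :=
    ((hr.mul_left 8).hasSum.tendsto_sum_nat).cauchySeq
  obtain ⟨K₁, hK₁⟩ := Metric.cauchySeq_iff.mp hS ε hε
  refine ⟨K₁, fun K K' hK hK' W hWm hW => ?_⟩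
  wlog hKK' : K ≤ K' generalizing K K'
  · rw [abs_sub_comm]; exact this K' K hK' hK (le_of_not_ge hKK')
  have h3 := abs_integral_sub_le_of_tilt_chain_uniformMass P μ μ' hPp hP hδ ht hWm hW hKK'
  have h4 : ∑ i ∈ Finset.Ico K K', 8 * r i < ε := by
    have h := hK₁ K' hK' K hK
    rw [Real.dist_eq, ← Finset.sum_Ico_eq_sub _ hKK'] at h
    exact (le_abs_self _).trans_lt h
  rw [← Finset.mul_sum] at h4
  rw [abs_sub_comm]
  linarith

end Abstract

/-! ## §2 The unit laws: uniformly Cauchy under the item's hypotheses -/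

section UnitLaws

variable (F : T3Family)

/-- **ONE REFINEMENT DEPTH**: if the refined family `F.refine n` at `γL^{-n}` (`γ ≥ 0`) has the all-heights unit tilt
`UnitTiltAt … 0` and the Gibbs masses of the complements of ALL its all-heights small-field events are `≤ δ`, then for every
`ε > 0` there is `K₁` with `|∫ W d(unitLaw K) − ∫ W d(unitLaw K')| ≤ 6δ + ε` for all `K, K' ≥ K₁` and all measurable `|W| ≤ 1`
on the refined unit torus (§1 along `unitLaw = (A_K)_*(Gibbs|good) + (A_K)_*(Gibbs|bad)`; at `m = 0` the K1 body compares exactly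
these events, `K / 0 = 0`). -/
theorem refine_unitLaw_uniform_near {γ b₀ p₀ : ℝ} (hγ : 0 ≤ γ) (n : ℕ)
    (hT : UnitTiltAt (F.refine n) (γ * ((F.L : ℝ)⁻¹) ^ n) b₀ p₀ 0) {δ : ℝ}
    (hM : ∀ K : ℕ, (gibbsK (F.refine n) ℰp (γ * ((F.L : ℝ)⁻¹) ^ n) K).real
      (histGood (F.refine n) ℰp (θBal (F.refine n).L (γ * ((F.L : ℝ)⁻¹) ^ n) b₀ p₀) K 0)ᶜ ≤ δ)
    {ε : ℝ} (hε : 0 < ε) :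
    ∃ K₁ : ℕ, ∀ K K' : ℕ, K₁ ≤ K → K₁ ≤ K' →
      ∀ W : GaugeField ((F.refine n).P 0) 0 (Matrix.specialUnitaryGroup (Fin 2) ℂ) → ℝ, Measurable W →
        (∀ u, |W u| ≤ 1) →
        |(∫ u, W u ∂(F.refine n).unitLaw ℰp measurableE_ℰp (γ * ((F.L : ℝ)⁻¹) ^ n) K) -
            ∫ u, W u ∂(F.refine n).unitLaw ℰp measurableE_ℰp (γ * ((F.L : ℝ)⁻¹) ^ n) K'| ≤ 6 * δ + ε := by
  have hγ' : 0 ≤ γ * ((F.L : ℝ)⁻¹) ^ n := mul_nonneg hγ (pow_nonneg (inv_nonneg.mpr (Nat.cast_nonneg _)) n)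
  obtain ⟨r, hr, htilt⟩ := hT
  have hGd : ∀ K, MeasurableSet (histGood (F.refine n) ℰp
      (θBal (F.refine n).L (γ * ((F.L : ℝ)⁻¹) ^ n) b₀ p₀) K 0) := fun K =>
    measurableSet_histGood (F.refine n) ℰp measurableE_ℰp _ K 0
  exact uniform_abs_integral_sub_le_of_tilt_uniformMass
    (fun K => (F.refine n).unitLaw ℰp measurableE_ℰp (γ * ((F.L : ℝ)⁻¹) ^ n) K)
    (fun K => Measure.map (unitA (F.refine n) ℰp K)
      ((gibbsK (F.refine n) ℰp (γ * ((F.L : ℝ)⁻¹) ^ n) K).restrict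
        (histGood (F.refine n) ℰp (θBal (F.refine n).L (γ * ((F.L : ℝ)⁻¹) ^ n) b₀ p₀) K 0)))
    (fun K => Measure.map (unitA (F.refine n) ℰp K)
      ((gibbsK (F.refine n) ℰp (γ * ((F.L : ℝ)⁻¹) ^ n) K).restrict
        (histGood (F.refine n) ℰp (θBal (F.refine n).L (γ * ((F.L : ℝ)⁻¹) ^ n) b₀ p₀) K 0)ᶜ))
    (fun K => isProbabilityMeasure_unitLaw measurableE_ℰp hγ' K)
    (fun K => unitLaw_eq_map_restrict_add measurableE_ℰp K (hGd K))
    (δ := δ) (fun K => by rw [real_map_restrict_univ measurableE_ℰp]; exact hM K)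
    hr (fun K => by simpa only [Nat.div_zero] using htilt K) hε

/-- **THE UNIT LAWS ARE UNIFORMLY CAUCHY** (the widening in total variation): under the hypotheses of the item
`WideningOfTiltAndMass` — `γ > 0`; for every `n ≥ n₀` the refined family `F.refine n` at `γL^{-n}` has the all-heights unit tilt
with summable radii; ONE `δ n → 0` bounds the complement masses of all its runs — for every `ε > 0` there is `J₀` with
`|∫ g d(unitLaw F ℰp γ J) − ∫ g d(unitLaw F ℰp γ J')| ≤ ε` for all `J, J' ≥ J₀` and ALL measurable unit-field observables
`|g| ≤ 1` of the ORIGINAL family (§1 at a depth `n` with `δ n < ε/12`, transported by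
`unitLaw^{F}_{K+n} = (Π_n)_* unitLaw^{F.refine n}_K`).  No crux and no summit is proved here. -/
theorem unitLaw_uniformCauchy {γ b₀ p₀ : ℝ} (n₀ : ℕ) (hγ : 0 < γ)
    (hT : ∀ n : ℕ, n₀ ≤ n → UnitTiltAt (F.refine n) (γ * ((F.L : ℝ)⁻¹) ^ n) b₀ p₀ 0)
    (hM : ∃ δ : ℕ → ℝ, Tendsto δ atTop (𝓝 0) ∧ ∀ n K : ℕ, n₀ ≤ n →
      (gibbsK (F.refine n) ℰp (γ * ((F.L : ℝ)⁻¹) ^ n) K).real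
        (histGood (F.refine n) ℰp (θBal (F.refine n).L (γ * ((F.L : ℝ)⁻¹) ^ n) b₀ p₀) K 0)ᶜ ≤ δ n)
    {ε : ℝ} (hε : 0 < ε) :
    ∃ J₀ : ℕ, ∀ J J' : ℕ, J₀ ≤ J → J₀ ≤ J' →
      ∀ g : GaugeField (F.P 0) 0 (Matrix.specialUnitaryGroup (Fin 2) ℂ) → ℝ, Measurable g → (∀ u, |g u| ≤ 1) →
        |(∫ u, g u ∂F.unitLaw ℰp measurableE_ℰp γ J) - ∫ u, g u ∂F.unitLaw ℰp measurableE_ℰp γ J'| ≤ ε := by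
  obtain ⟨δ, hδ, hmass⟩ := hM
  -- a refinement depth `n ≥ n₀` with `δ n < ε/12`
  obtain ⟨n, hn₀, hn⟩ : ∃ n, n₀ ≤ n ∧ δ n < ε / 12 := by
    obtain ⟨n, hn⟩ := ((hδ.eventually (gt_mem_nhds (by positivity : (0 : ℝ) < ε / 12))).and
      (eventually_ge_atTop n₀)).exists
    exact ⟨n, hn.2, hn.1⟩
  obtain ⟨K₁, hK₁⟩ := refine_unitLaw_uniform_near F hγ.le n (hT n hn₀) (fun K => hmass n K hn₀) (half_pos hε)
  refine ⟨K₁ + n, fun J J' hJ hJ' g hgm hg1 => ?_⟩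
  obtain ⟨K, rfl⟩ := Nat.exists_eq_add_of_le' ((Nat.le_add_left n K₁).trans hJ)
  obtain ⟨K', rfl⟩ := Nat.exists_eq_add_of_le' ((Nat.le_add_left n K₁).trans hJ')
  have hmc := measurable_coarsen F n ℰp measurableE_ℰp (G := Matrix.specialUnitaryGroup (Fin 2) ℂ)
  rw [unitLaw_add_eq_map_coarsen F n ℰp measurableE_ℰp hγ.le K,
    unitLaw_add_eq_map_coarsen F n ℰp measurableE_ℰp hγ.le K',
    integral_map hmc.aemeasurable hgm.aestronglyMeasurable,
    integral_map hmc.aemeasurable hgm.aestronglyMeasurable]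
  have h := hK₁ K K' (Nat.le_of_add_le_add_right hJ) (Nat.le_of_add_le_add_right hJ')
    (fun u => g (coarsen F n ℰp u)) (hgm.comp hmc) (fun u => hg1 _)
  linarith

/-- **EVENT MASSES CONVERGE UNIFORMLY IN THE EVENT**: under the same hypotheses, for every `ε > 0` there is `J₀` with
`|unitLaw_J(A) − unitLaw_{J'}(A)| ≤ ε` for all `J, J' ≥ J₀` and ALL measurable events `A` of unit-lattice fields (indicators are
measurable and bounded by `1`). -/
theorem unitLaw_real_uniformCauchy {γ b₀ p₀ : ℝ} (n₀ : ℕ) (hγ : 0 < γ)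
    (hT : ∀ n : ℕ, n₀ ≤ n → UnitTiltAt (F.refine n) (γ * ((F.L : ℝ)⁻¹) ^ n) b₀ p₀ 0)
    (hM : ∃ δ : ℕ → ℝ, Tendsto δ atTop (𝓝 0) ∧ ∀ n K : ℕ, n₀ ≤ n →
      (gibbsK (F.refine n) ℰp (γ * ((F.L : ℝ)⁻¹) ^ n) K).real
        (histGood (F.refine n) ℰp (θBal (F.refine n).L (γ * ((F.L : ℝ)⁻¹) ^ n) b₀ p₀) K 0)ᶜ ≤ δ n)
    {ε : ℝ} (hε : 0 < ε) :
    ∃ J₀ : ℕ, ∀ J J' : ℕ, J₀ ≤ J → J₀ ≤ J' →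
      ∀ A : Set (GaugeField (F.P 0) 0 (Matrix.specialUnitaryGroup (Fin 2) ℂ)), MeasurableSet A →
        |(F.unitLaw ℰp measurableE_ℰp γ J).real A - (F.unitLaw ℰp measurableE_ℰp γ J').real A| ≤ ε := by
  obtain ⟨J₀, hJ₀⟩ := unitLaw_uniformCauchy F n₀ hγ hT hM hε
  refine ⟨J₀, fun J J' hJ hJ' A hA => ?_⟩
  have hb : ∀ y, |A.indicator (1 : GaugeField (F.P 0) 0 (Matrix.specialUnitaryGroup (Fin 2) ℂ) → ℝ) y| ≤ 1 := fun y => by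
    by_cases hy : y ∈ A
    · simp [hy]
    · simp [hy]
  have h := hJ₀ J J' hJ hJ' _ (measurable_one.indicator hA) hb
  rwa [integral_indicator_one hA, integral_indicator_one hA] at h

end UnitLaws

/-! ## §3 Cauchy unit laws give the item's conclusion back (every `G`, every measurable `ℰ`) -/

section Consequence

variable (F : T3Family) {G : Type*} [GaugeGroup G] [MeasurableSpace G] [HaarData G] [RegularGaugeGroup G]
  (ℰ : LoopAverage G) (hE : ℰ.MeasurableE)

/-- Products of a list of measurable real functions are measurable (local helper). -/
private theorem measurable_list_prod {Y : Type*} [MeasurableSpace Y] {ι : Type*} (f : ι → Y → ℝ)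
    (hf : ∀ i, Measurable (f i)) : ∀ l : List ι, Measurable fun x => (l.map fun i => f i x).prod
  | [] => by simp
  | i :: l => by
    show Measurable fun x => f i x * (l.map fun i => f i x).prod
    exact (hf i).mul (measurable_list_prod f hf l)

/-- Products of a list of functions bounded by `1` are bounded by `1` (local helper). -/
private theorem abs_list_prod_le_one {Y : Type*} {ι : Type*} (f : ι → Y → ℝ) (hf : ∀ i x, |f i x| ≤ 1) (x : Y) :
    ∀ l : List ι, |(l.map fun i => f i x).prod| ≤ 1
  | [] => by simp
  | i :: l => by
    rw [List.map_cons, List.prod_cons, abs_mul]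
    exact mul_le_one₀ (hf i x) (abs_nonneg _) (abs_list_prod_le_one f hf x l)

/-- **CAUCHY UNIT LAWS ⇒ THE CONTINUUM LIMIT OF ALL JOINT EXPECTATIONS** (every `G`, every measurable `ℰ`, `γ ≥ 0`): if for
every measurable unit-field observable `|W| ≤ 1` the unit-law integrals form a Cauchy sequence, then
`HasContinuumLimit (F.scheme ℰ γ)` (`expectAt_eq_integral_unitLaw`: the joint expectations are such integrals, of the bounded
measurable unit-loop products). -/
theorem hasContinuumLimit_of_unitLaw_cauchySeq {γ : ℝ} (hγ : 0 ≤ γ)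
    (h : ∀ W : GaugeField (F.P 0) 0 G → ℝ, Measurable W → (∀ u, |W u| ≤ 1) →
      CauchySeq fun K => ∫ u, W u ∂F.unitLaw ℰ hE γ K) :
    HasContinuumLimit (F.scheme ℰ γ) := by
  intro Cs
  obtain ⟨l, hl⟩ := cauchySeq_tendsto_of_complete (h _
    (measurable_list_prod (fun (C : ULoop3 F) (u : GaugeField (F.P 0) 0 G) => loopAt u (C.1.atLevel 0))
      (fun C => measurable_loopAt _) Cs)
    (fun u => abs_list_prod_le_one (fun (C : ULoop3 F) (u : GaugeField (F.P 0) 0 G) => loopAt u (C.1.atLevel 0))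
      (fun C u => abs_loopAt_le_one _ _) u Cs))
  refine ⟨l, ?_⟩
  have hkey : (fun K => (F.scheme ℰ γ).expectAt K Cs) =
      fun K => ∫ u, (Cs.map fun C => loopAt u (C.1.atLevel 0)).prod ∂F.unitLaw ℰ hE γ K :=
    funext fun K => expectAt_eq_integral_unitLaw hE hγ K Cs
  rw [hkey]
  exact hl

/-- **THE ITEM'S CONCLUSION, RE-DERIVED THROUGH TOTAL VARIATION** (`SU(2)`, `ℰp`; the hypotheses of `WideningOfTiltAndMass`
spelled out): uniformly Cauchy unit laws (§2) ⇒ Cauchy integrals observable by observable ⇒ `HasContinuumLimit (F.scheme ℰp γ)`.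
Recorded only to certify that §2 is the stronger statement; the item stmt-QuantumFields-22885 is closed by
`smallFieldWidening_wideningOfTiltAndMass_proof`. -/
theorem hasContinuumLimit_of_unitLaw_uniformCauchy {γ b₀ p₀ : ℝ} (n₀ : ℕ) (hγ : 0 < γ)
    (hT : ∀ n : ℕ, n₀ ≤ n → UnitTiltAt (F.refine n) (γ * ((F.L : ℝ)⁻¹) ^ n) b₀ p₀ 0)
    (hM : ∃ δ : ℕ → ℝ, Tendsto δ atTop (𝓝 0) ∧ ∀ n K : ℕ, n₀ ≤ n →
      (gibbsK (F.refine n) ℰp (γ * ((F.L : ℝ)⁻¹) ^ n) K).real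
        (histGood (F.refine n) ℰp (θBal (F.refine n).L (γ * ((F.L : ℝ)⁻¹) ^ n) b₀ p₀) K 0)ᶜ ≤ δ n) :
    HasContinuumLimit (F.scheme ℰp γ) := by
  refine hasContinuumLimit_of_unitLaw_cauchySeq F ℰp measurableE_ℰp hγ.le fun W hWm hW1 => ?_
  refine Metric.cauchySeq_iff.mpr fun ε hε => ?_
  obtain ⟨J₀, hJ₀⟩ := unitLaw_uniformCauchy F n₀ hγ hT hM (half_pos hε)
  exact ⟨J₀, fun J hJ J' hJ' => by
    rw [Real.dist_eq]; exact (hJ₀ J J' hJ hJ' W hWm hW1).trans_lt (half_lt_self hε)⟩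

end Consequence

end Summit.QuantumFields.YangMills.Theorems.WideningTV

end
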